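import Summits.ValiantsHypothesis.ValiantsHypothesis.Theorems.FeketeSOSFeketeSOSHardPaleyRIPDefs
import Summits.ValiantsHypothesis.ValiantsHypothesis.Theorems.FeketeSOSFeketeSOSHardPaleyRIPRankOneTame
import Mathlib.Analysis.SpecialFunctions.Pow.Complex
import Mathlib.Algebra.Polynomial.Coeff
import Mathlib.Algebra.Polynomial.Degree.Defs

/-!
# Route FeketeSOS — crux `FeketeSOSHard` (stmt-ValiantsHypothesis-3996), line `paley-rip`:
# the general dual pairing `⟨z, pattern⟩ = Σ_i c_i · w_iᵀ H(z) w_i` and rank-one operator tameness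
# in the line's vocabulary

The landed mass identity (`stub_paleyMassIdentity`, p565369) pairs a cyclic representation
`X^p − 1 ∣ Σ_i c_i w_i² − F` with the Legendre symbol.  Every archimedean lower bound of the line
(completion, flat-RIP, trivial range; `…TameStatus.lean`) and every dual certificate of the proposed operator
stub `stub_tameOperator` (candidate skeleton `Cruxes/FeketeSOSHard/Lines/paley_rip_v3.lean`) is an instance of
the same identity with an ARBITRARY `p`-periodic weight `z : ℤ/p → ℂ` in place of `χ_p`:

* `ztwist_*` — the `ℂ`-linear functional `L_z(f) = Σ_e z(e mod p) f_e` (`Polynomial.lsum`, spelled out) kills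
  the multiples of `X^p − 1`, maps a square `w²` to the partial-Hankel bilinear form
  `Σ_{a,b ∈ supp w} z(a+b) w_a w_b = wᵀ H(z) w`, and maps `F` with `deg F < p` to `Σ_{n<p} z(n) F_n`;
* `pairing_of_dvd` — hence `Σ_{n<p} z(n) F_n = Σ_i c_i Σ_{a,b} z(a+b) (w_i)_a (w_i)_b` for every cyclic
  representation (the nuclear-norm/operator-norm duality of the line, at the level of an identity);
* `coeff_eq_cyclicConv` — with `z = 𝟙_{n}`: the `n`-th coefficient of the cyclic pattern `F` of ONE weighted
  square `c·w²` (`supp w ⊆ [0,p)`) is the cyclic self-convolution `c · Σ_{x ∈ ℤ/p} w(x) w(n − x)`;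
* `tameOperator_rank_one` — the case `r = 1` of `stub_tameOperator` VERBATIM up to the constants
  (`K = 1`, `ε = 0`): a single weighted square supported in `S ⊆ [0,p)` whose cyclic pattern has coefficients
  of modulus `≤ M` has mass `|c|·‖w‖₂² ≤ #S · M` (by `rankOne_tame`, p578134, on `ℤ/p` with
  `T = S + S mod p`, `#T ≤ #S²`).  It validates the typing of the candidate stub on its first rung.

Honest framing: `r ≥ 2` of `stub_tameOperator`, the engine `stub_paleyFlatRIP`, the registered
`stub_tameReduction` (crux-equivalent modulo the engine, p576568) and the crux stay OPEN; `VP ≠ VNP` untouched.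
-/

set_option linter.dupNamespace false

namespace Summit.ValiantsHypothesis.ValiantsHypothesis.Theorems.FeketeSOSHardPaleyRIP

open Polynomial Finset
open scoped BigOperators

noncomputable section

section ZTwist

variable (p : ℕ) [Fact p.Prime] (z : ZMod p → ℂ)

/-- `L_z(c · X^e) = z(e) · c`. [folklore] -/
theorem ztwist_C_mul_X_pow (c : ℂ) (e : ℕ) :
    (Polynomial.lsum (fun e : ℕ => (z (e : ZMod p)) • (LinearMap.id : ℂ →ₗ[ℂ] ℂ)) : ℂ[X] →ₗ[ℂ] ℂ)
      (C c * X ^ e) = z (e : ZMod p) * c := by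
  rw [Polynomial.lsum_apply, Polynomial.C_mul_X_pow_eq_monomial, Polynomial.sum_monomial_index]
  · simp
  · simp

/-- Periodicity: `L_z(X^p · f) = L_z(f)`. [folklore] -/
theorem ztwist_X_pow_mul (f : ℂ[X]) :
    (Polynomial.lsum (fun e : ℕ => (z (e : ZMod p)) • (LinearMap.id : ℂ →ₗ[ℂ] ℂ)) : ℂ[X] →ₗ[ℂ] ℂ)
      (X ^ p * f) =
    (Polynomial.lsum (fun e : ℕ => (z (e : ZMod p)) • (LinearMap.id : ℂ →ₗ[ℂ] ℂ)) : ℂ[X] →ₗ[ℂ] ℂ) f := by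
  induction f using Polynomial.induction_on' with
  | add f g hf hg => rw [mul_add, map_add, map_add, hf, hg]
  | monomial e c =>
    rw [← Polynomial.C_mul_X_pow_eq_monomial, mul_comm (X ^ p), mul_assoc, ← pow_add,
      ztwist_C_mul_X_pow, ztwist_C_mul_X_pow]
    congr 2
    push_cast
    rw [ZMod.natCast_self, add_zero]

/-- `L_z` kills the multiples of `X^p − 1`. [folklore] -/
theorem ztwist_eq_zero_of_dvd {f : ℂ[X]} (h : (X : ℂ[X]) ^ p - 1 ∣ f) :
    (Polynomial.lsum (fun e : ℕ => (z (e : ZMod p)) • (LinearMap.id : ℂ →ₗ[ℂ] ℂ)) : ℂ[X] →ₗ[ℂ] ℂ) f = 0 := by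
  obtain ⟨q, rfl⟩ := h
  rw [sub_mul, one_mul, map_sub, ztwist_X_pow_mul, sub_self]

/-- On a square, `L_z` is the partial-Hankel bilinear form of the coefficient vector:
`L_z(w²) = Σ_{a,b ∈ supp w} z(a+b) w_a w_b`. [folklore] -/
theorem ztwist_sq (w : ℂ[X]) :
    (Polynomial.lsum (fun e : ℕ => (z (e : ZMod p)) • (LinearMap.id : ℂ →ₗ[ℂ] ℂ)) : ℂ[X] →ₗ[ℂ] ℂ) (w ^ 2) =
      ∑ a ∈ w.support, ∑ b ∈ w.support, z ((a + b : ℕ) : ZMod p) * w.coeff a * w.coeff b := by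
  have hw : w = ∑ a ∈ w.support, C (w.coeff a) * X ^ a := as_sum_support_C_mul_X_pow w
  conv_lhs => rw [sq, hw, Finset.sum_mul]
  simp_rw [Finset.mul_sum]
  rw [map_sum]
  simp_rw [map_sum]
  refine Finset.sum_congr rfl fun a _ => Finset.sum_congr rfl fun b _ => ?_
  have hmul : C (w.coeff a) * X ^ a * (C (w.coeff b) * X ^ b) = C (w.coeff a * w.coeff b) * X ^ (a + b) := by
    rw [map_mul, pow_add]; ring
  rw [hmul, ztwist_C_mul_X_pow]
  ring

/-- On a polynomial of degree `< p`, `L_z(F) = Σ_{n<p} z(n) F_n`. [folklore] -/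
theorem ztwist_of_natDegree_lt {F : ℂ[X]} (hF : F.natDegree < p) :
    (Polynomial.lsum (fun e : ℕ => (z (e : ZMod p)) • (LinearMap.id : ℂ →ₗ[ℂ] ℂ)) : ℂ[X] →ₗ[ℂ] ℂ) F =
      ∑ n ∈ range p, z (n : ZMod p) * F.coeff n := by
  have hF' : F = ∑ n ∈ range p, C (F.coeff n) * X ^ n := by
    conv_lhs => rw [as_sum_range' F p hF]
    simp_rw [C_mul_X_pow_eq_monomial]
  conv_lhs => rw [hF']
  rw [map_sum]
  exact Finset.sum_congr rfl fun n _ => ztwist_C_mul_X_pow p z _ _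

end ZTwist

/-- **The dual pairing identity.**  For every cyclic representation `X^p − 1 ∣ Σ_i c_i w_i² − F` over `ℂ`
with `deg F < p` and every weight `z : ℤ/p → ℂ`:
`Σ_{n<p} z(n) F_n = Σ_i c_i · Σ_{a,b ∈ supp w_i} z(a+b) (w_i)_a (w_i)_b`, i.e. `⟨z, pattern⟩ = ⟨H(z), τ⟩`
for the Gram matrix `τ = Σ c_i w_i w_iᵀ`.  (`z = χ_p`, `F = F_p` is `stub_paleyMassIdentity`.) [folklore] -/
theorem pairing_of_dvd (p : ℕ) [Fact p.Prime] (z : ZMod p → ℂ) (s : ℕ) (c : Fin s → ℂ)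
    (w : Fin s → ℂ[X]) (F : ℂ[X]) (hF : F.natDegree < p)
    (hdvd : (X : ℂ[X]) ^ p - 1 ∣ (∑ i, C (c i) * w i ^ 2) - F) :
    ∑ n ∈ range p, z (n : ZMod p) * F.coeff n =
      ∑ i, c i * ∑ a ∈ (w i).support, ∑ b ∈ (w i).support,
        z ((a + b : ℕ) : ZMod p) * (w i).coeff a * (w i).coeff b := by
  have h0 := ztwist_eq_zero_of_dvd p z hdvd
  rw [map_sub, sub_eq_zero, map_sum, ztwist_of_natDegree_lt p z hF] at h0
  rw [← h0]
  refine Finset.sum_congr rfl fun i _ => ?_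
  rw [← ztwist_sq, ← smul_eq_C_mul, map_smul, smul_eq_mul]

/-- **Coefficients of the cyclic pattern of one square are cyclic self-convolutions.**  If `supp w ⊆ [0,p)`,
`deg F < p` and `X^p − 1 ∣ c·w² − F`, then for every residue `n`,
`F_{n} = c · Σ_{x ∈ ℤ/p} w(x) w(n − x)` (coefficients read through `ZMod.val`). [folklore] -/
theorem coeff_eq_cyclicConv (p : ℕ) [Fact p.Prime] (c : ℂ) (w F : ℂ[X])
    (hw : ∀ a ∈ w.support, a < p) (hF : F.natDegree < p)
    (hdvd : (X : ℂ[X]) ^ p - 1 ∣ C c * w ^ 2 - F) (n : ZMod p) :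
    F.coeff n.val = c * ∑ x : ZMod p, w.coeff x.val * w.coeff (n - x).val := by
  classical
  -- pair with the indicator of the residue `n`
  have h := pairing_of_dvd p (fun m => if m = n then 1 else 0) 1 (fun _ => c) (fun _ => w) F hF
    (by simpa using hdvd)
  simp only [Finset.univ_unique, Finset.sum_singleton] at h
  -- left side: only `m = n.val` survives
  have hl : ∑ m ∈ range p, (if ((m : ℕ) : ZMod p) = n then (1 : ℂ) else 0) * F.coeff m = F.coeff n.val := by
    rw [Finset.sum_eq_single n.val]
    · simp
    · intro m hm hne
      have : ((m : ℕ) : ZMod p) ≠ n := by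
        intro hmn
        apply hne
        rw [← hmn, ZMod.val_natCast, Nat.mod_eq_of_lt (mem_range.1 hm)]
      simp [this]
    · intro hn
      exact absurd (mem_range.2 (ZMod.val_lt n)) hn
  rw [hl] at h
  rw [h]
  congr 1
  -- right side: for fixed `a`, the unique `b < p` with `a + b ≡ n` is `(n - a).val`
  have hinner : ∀ a ∈ w.support,
      ∑ b ∈ w.support, (if (((a + b : ℕ) : ZMod p)) = n then (1 : ℂ) else 0) * w.coeff a * w.coeff b
        = w.coeff a * w.coeff (n - (a : ZMod p)).val := by
    intro a ha
    have key : ∀ b ∈ w.support, ((((a + b : ℕ) : ZMod p)) = n ↔ b = (n - (a : ZMod p)).val) := by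
      intro b hb
      constructor
      · intro hab
        have : (b : ZMod p) = n - (a : ZMod p) := by
          rw [← hab]; push_cast; ring
        rw [← this, ZMod.val_natCast, Nat.mod_eq_of_lt (hw b hb)]
      · intro hb'
        rw [hb']; push_cast; rw [ZMod.natCast_zmod_val]; ring
    have hsum : ∑ b ∈ w.support, (if (((a + b : ℕ) : ZMod p)) = n then (1 : ℂ) else 0) * w.coeff a * w.coeff b
        = ∑ b ∈ w.support, (if b = (n - (a : ZMod p)).val then w.coeff a * w.coeff b else 0) := by
      refine Finset.sum_congr rfl fun b hb => ?_
      by_cases hb' : b = (n - (a : ZMod p)).val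
      · rw [if_pos ((key b hb).2 hb'), if_pos hb', one_mul]
      · rw [if_neg (fun h' => hb' ((key b hb).1 h')), if_neg hb', zero_mul, zero_mul]
    rw [hsum, Finset.sum_ite_eq' w.support]
    split_ifs with hmem
    · rfl
    · rw [notMem_support_iff.1 hmem, mul_zero]
  rw [Finset.sum_congr rfl hinner]
  -- reindex `supp w ⊆ [0,p)` against `ZMod p` through `val`
  symm
  rw [← Finset.sum_subset (Finset.subset_univ ((w.support).image (fun a : ℕ => (a : ZMod p))))]
  · rw [Finset.sum_image]
    · refine Finset.sum_congr rfl fun a ha => ?_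
      rw [ZMod.val_natCast, Nat.mod_eq_of_lt (hw a ha)]
    · intro a ha b hb hab
      have := (ZMod.natCast_eq_natCast_iff' a b p).1 hab
      rwa [Nat.mod_eq_of_lt (hw a ha), Nat.mod_eq_of_lt (hw b hb)] at this
  · intro x _ hx
    have : x.val ∉ w.support := by
      intro hmem
      exact hx (Finset.mem_image.2 ⟨x.val, hmem, ZMod.natCast_zmod_val x⟩)
    rw [notMem_support_iff.1 this, zero_mul]

/-- **Rank-one operator tameness in the line's vocabulary** (the case `r = 1` of the candidate stub
`stub_tameOperator`, with `K = 1` and exponent `1`): a single weighted square `c·w²` with `supp w ⊆ S ⊆ [0,p)`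
whose cyclic pattern `F` (`deg F < p`, `X^p − 1 ∣ c w² − F`) has all coefficients of modulus `≤ M` has
archimedean mass `|c| · Σ_a |w_a|² ≤ #S · M`; in particular the conclusion of `stub_tameOperator` holds for it
with the same square.  Proof: `rankOne_tame` on `ℤ/p` for `x ↦ γ w(x)` (`γ² = c`) with `T = S + S mod p`,
`#T ≤ #S²`, and `coeff_eq_cyclicConv`. [folklore] -/
theorem tameOperator_rank_one (p : ℕ) [Fact p.Prime] (S : Finset ℕ) (hS : ∀ a ∈ S, a < p)
    (c : ℂ) (w : ℂ[X]) (hw : w.support ⊆ S) (F : ℂ[X]) (M : ℝ) (hF : F.natDegree < p)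
    (hdvd : (X : ℂ[X]) ^ p - 1 ∣ C c * w ^ 2 - F) (hM : ∀ n, ‖F.coeff n‖ ≤ M) :
    sqMass c w ≤ (S.card : ℝ) * M := by
  classical
  have hp : NeZero p := ⟨(Fact.out : p.Prime).ne_zero⟩
  have hM0 : 0 ≤ M := (norm_nonneg _).trans (hM 0)
  -- a square root of `c`
  obtain ⟨γ, hγ⟩ : ∃ γ : ℂ, γ ^ 2 = c := ⟨c ^ ((2 : ℂ)⁻¹), Complex.cpow_nat_inv_pow c two_ne_zero⟩
  set W : ZMod p → ℂ := fun x => γ * w.coeff x.val with hWdef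
  -- mass of `W` is `sqMass c w`
  have hmass : ∑ x : ZMod p, ‖W x‖ ^ 2 = sqMass c w := by
    unfold sqMass
    have hγn : ‖γ‖ ^ 2 = ‖c‖ := by rw [← norm_pow, hγ]
    simp only [hWdef, norm_mul, mul_pow, hγn, ← Finset.mul_sum]
    congr 1
    symm
    rw [← Finset.sum_subset (Finset.subset_univ ((w.support).image (fun a : ℕ => (a : ZMod p))))]
    · rw [Finset.sum_image]
      · refine Finset.sum_congr rfl fun a ha => ?_
        rw [ZMod.val_natCast, Nat.mod_eq_of_lt (hS a (hw ha))]
      · intro a ha b hb hab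
        have := (ZMod.natCast_eq_natCast_iff' a b p).1 hab
        rwa [Nat.mod_eq_of_lt (hS a (hw ha)), Nat.mod_eq_of_lt (hS b (hw hb))] at this
    · intro x _ hx
      have : x.val ∉ w.support := fun hmem =>
        hx (Finset.mem_image.2 ⟨x.val, hmem, ZMod.natCast_zmod_val x⟩)
      rw [notMem_support_iff.1 this, norm_zero]; ring
  -- the self-convolution of `W` is the cyclic pattern
  have hconv : ∀ n : ZMod p, ∑ x, W x * W (n - x) = F.coeff n.val := by
    intro n
    rw [coeff_eq_cyclicConv p c w F (fun a ha => hS a (hw ha)) hF hdvd n, ← hγ, Finset.mul_sum]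
    refine Finset.sum_congr rfl fun x _ => ?_
    simp only [hWdef]; ring
  -- it vanishes off `T = S + S mod p`
  set T : Finset (ZMod p) := (S ×ˢ S).image (fun ab : ℕ × ℕ => ((ab.1 + ab.2 : ℕ) : ZMod p)) with hTdef
  have hT : ∀ n, n ∉ T → ∑ x, W x * W (n - x) = 0 := by
    intro n hn
    refine Finset.sum_eq_zero fun x _ => ?_
    by_cases hx : x.val ∈ S
    · by_cases hy : (n - x).val ∈ S
      · exfalso
        refine hn (Finset.mem_image.2 ⟨(x.val, (n - x).val), Finset.mem_product.2 ⟨hx, hy⟩, ?_⟩)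
        push_cast
        rw [ZMod.natCast_zmod_val, ZMod.natCast_zmod_val]; ring
      · have : w.coeff (n - x).val = 0 := notMem_support_iff.1 fun h => hy (hw h)
        simp [hWdef, this]
    · have : w.coeff x.val = 0 := notMem_support_iff.1 fun h => hx (hw h)
      simp [hWdef, this]
  have hTcard : (T.card : ℝ) ≤ (S.card : ℝ) ^ 2 := by
    have h1 : T.card ≤ (S ×ˢ S).card := Finset.card_image_le
    rw [Finset.card_product] at h1
    exact_mod_cast (by nlinarith [h1] : T.card ≤ S.card ^ 2)
  -- rank-one tameness on `ℤ/p`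
  have hrk := rankOne_tame W M T (fun n => by rw [hconv n]; exact hM _) hT
  rw [hmass] at hrk
  -- `(sqMass)^2 ≤ #T M² ≤ (#S M)²`
  have hsq : sqMass c w ^ 2 ≤ ((S.card : ℝ) * M) ^ 2 := by
    calc sqMass c w ^ 2 ≤ (T.card : ℝ) * M ^ 2 := hrk
      _ ≤ (S.card : ℝ) ^ 2 * M ^ 2 := mul_le_mul_of_nonneg_right hTcard (sq_nonneg _)
      _ = ((S.card : ℝ) * M) ^ 2 := by ring
  have hmass0 : 0 ≤ sqMass c w := by
    unfold sqMass; exact mul_nonneg (norm_nonneg _) (sum_nonneg fun a _ => sq_nonneg _)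
  exact (pow_le_pow_iff_left₀ hmass0 (mul_nonneg (Nat.cast_nonneg _) hM0) two_ne_zero).1 hsq

end

end Summit.ValiantsHypothesis.ValiantsHypothesis.Theorems.FeketeSOSHardPaleyRIP
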